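import Literature.AnabelianGeometry.Anabelioids.BCatFundamentalGroup
import Literature.AnabelianGeometry.Anabelioids.BasicProofs
import Literature.AnabelianGeometry.SemiGraphs.FiniteCoveringsComparison
import Literature.AnabelianGeometry.SemiGraphs.BranchSubgroupLemmas
import Literature.AnabelianGeometry.SemiGraphs.TemperedVerticial
import HarnessLib

/-!
# [SemiAnbd] §2/§3: the two presentations of a semi-graph of anabelioids — vertex/edge level

Mochizuki, *Semi-graphs of anabelioids*, Publ. RIMS **42** (2006), Def. 2.1 pp. 22–24
[cite: MochizukiSemiAnbd2006, Def. 2.1 pp.22-24].  The tree carries two presentations of a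
semi-graph of anabelioids: the categorical one of §2 (`SemiGraphOfAnabelioids`: Galois categories
`𝒢_v`, `𝒢_e`, exact pull-back functors `b^*`; fundamental groups `Π_v = Aut F` for basepoints `F`,
branch subgroups `Π_b ⊆ Π_v` transported along `α : b^* ⋙ F_e ≅ F`) and the profinite-group one of
§3 (`ProfiniteSemiGraph`: profinite `Π_v`, `Π_e`, continuous `b_* : Π_e → Π_v`), related by
`ProfiniteSemiGraph.toAnab` (`{B(Π_v), B(Π_e), B(b_*)}`).  This file is the BRIDGE at the level of
vertices and edges, at the forgetful basepoints (`π₁(B(Π)) = Π`, `BCatFundamentalGroup.lean`):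

* `fiberFunctor_forget_bCat` — the forgetful functor of `B(Π)` is a fibre functor (exported form of
  the construction inside `galoisCategory_bCat`);
* `toAnab_pull_pullback` — `b^* = res (b_*)` definitionally;
* `exists_piV_equiv` — `Π_v ≃ₜ* Aut(forget) = 𝒢.toAnab.PiV v _`, acting as `ρ`;
* `branchSubgroup_toAnab_eq` — the §2 branch subgroup at the forgetful basepoints (transport
  `Iso.refl`) is the image of the §3 branch subgroup `range b_*` under that identification;
* `isOfInjectiveType_toAnab_iff`, `isVerticiallySlim_toAnab_iff` — the §2 and §3 renderings of
  "of injective type" and "verticially slim" agree.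

(The aloof/estranged transfer waits for the repair of `EdgeIntersectionCondition`; the global
`Π_𝒢` / tempered bridge is a sequel.)  Proof-only file.
-/

noncomputable section

namespace Literature.AnabelianGeometry.Anabelioids

open CategoryTheory CategoryTheory.Limits CategoryTheory.PreGaloisCategory
open Literature.AlgebraicGeometry.Frobenioids (BCat IsSlimGroup)
open scoped FintypeCatDiscrete

universe u

/-- The forgetful functor `B(G) → FinSets` is a fibre functor (for any topological group `G`):
(G4)–(G6) transfer from Mathlib's `Action.forget`, continuity being closed under finite
(co)limits. [cite: MochizukiGeoAn2004, §1.1 p.9] -/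
theorem fiberFunctor_forget_bCat (G : Type u) [Group G] [TopologicalSpace G]
    [IsTopologicalGroup G] :
    letI := galoisCategory_bCat G
    FiberFunctor (ObjectProperty.ι (Action.IsContinuous (V := FintypeCat.{u}) (G := G)) ⋙
      Action.forget FintypeCat.{u} G) := by
  letI := galoisCategory_bCat G
  haveI hlim : ∀ (J : Type) [SmallCategory J] [FinCategory J],
      ObjectProperty.IsClosedUnderLimitsOfShape
        (Action.IsContinuous (V := FintypeCat.{u}) (G := G)) J :=
    fun J _ _ => isClosedUnderLimitsOfShape_isContinuous J
  haveI hcolim : ∀ (J : Type) [SmallCategory J] [FinCategory J],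
      ObjectProperty.IsClosedUnderColimitsOfShape
        (Action.IsContinuous (V := FintypeCat.{u}) (G := G)) J :=
    fun J _ _ => isClosedUnderColimitsOfShape_isContinuous J
  haveI : ∀ (J : Type) [SmallCategory J] [FinCategory J], PreservesLimitsOfShape J
      (ObjectProperty.ι (Action.IsContinuous (V := FintypeCat.{u}) (G := G)) ⋙
        Action.forget FintypeCat.{u} G) :=
    fun J _ _ => inferInstance
  haveI : ∀ (J : Type) [SmallCategory J] [FinCategory J], PreservesColimitsOfShape J
      (ObjectProperty.ι (Action.IsContinuous (V := FintypeCat.{u}) (G := G)) ⋙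
        Action.forget FintypeCat.{u} G) :=
    fun J _ _ => inferInstance
  exact
    { preservesTerminalObjects := inferInstance
      preservesPullbacks := inferInstance
      preservesFiniteCoproducts := ⟨fun _ => inferInstance⟩
      preservesEpis := inferInstance
      preservesQuotientsByFiniteGroups := fun H _ _ => by
        obtain ⟨H', _, _, ⟨e⟩⟩ :
            ∃ (H' : Type) (_ : Group H') (_ : Fintype H'), Nonempty (H ≃* H') :=
          Finite.exists_type_univ_nonempty_mulEquiv H
        exact preservesColimitsOfShape_of_equiv e.toSingleObjEquiv.symm _
      reflectsIsos := ⟨fun f hf => by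
        haveI : IsIso f.hom.hom := hf
        haveI : IsIso f.hom := inferInstance
        exact (ObjectProperty.isIso_hom_iff f).mp this⟩ }

/-- Slimness of a topological group is invariant under isomorphisms of topological groups.
[folklore] -/
private theorem isSlimGroup_of_continuousMulEquiv {G₁ G₂ : Type*} [Group G₁]
    [TopologicalSpace G₁] [Group G₂] [TopologicalSpace G₂] (e : G₁ ≃ₜ* G₂)
    (h : IsSlimGroup G₁) : IsSlimGroup G₂ := by
  refine ⟨fun H hH => ?_⟩
  have hH' : IsOpen ((H.comap e.toMonoidHom : Subgroup G₁) : Set G₁) := hH.preimage e.continuous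
  have h1 := h.centralizer_eq_bot (H.comap e.toMonoidHom) hH'
  rw [eq_bot_iff] at h1 ⊢
  intro z hz
  have hz' :
      e.symm z ∈ Subgroup.centralizer ((H.comap e.toMonoidHom : Subgroup G₁) : Set G₁) := by
    rw [Subgroup.mem_centralizer_iff]
    intro g hg
    apply e.injective
    have := Subgroup.mem_centralizer_iff.mp hz (e g) hg
    simpa using this
  have := h1 hz'
  rw [Subgroup.mem_bot] at this ⊢
  simpa using congrArg e this

/-- **`B(G)` is slim iff `G` is slim** (as connected anabelioid, [GeoAn] Def. 1.2.4 (ii): `π₁` slim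
at every basepoint), for `G` profinite: `π₁(B(G)) = G`. [cite: MochizukiGeoAn2004, Def. 1.2.4(ii) p.18] -/
theorem isSlim_bCat_iff_isSlimGroup (G : Type u) [Group G] [TopologicalSpace G]
    [IsTopologicalGroup G] [CompactSpace G] [TotallyDisconnectedSpace G] :
    letI := galoisCategory_bCat G
    IsSlim (BCat G) ↔ IsSlimGroup G := by
  letI := galoisCategory_bCat G
  haveI := fiberFunctor_forget_bCat G
  obtain ⟨e, -⟩ := exists_continuousMulEquiv_aut_forget (G := G)
  rw [isSlim_iff_isSlimGroup_aut
    (ObjectProperty.ι (Action.IsContinuous (V := FintypeCat.{u}) (G := G)) ⋙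
      Action.forget FintypeCat.{u} G)]
  exact ⟨isSlimGroup_of_continuousMulEquiv e.symm, isSlimGroup_of_continuousMulEquiv e⟩

end Literature.AnabelianGeometry.Anabelioids

namespace Literature.AnabelianGeometry.SemiGraphs

open CategoryTheory CategoryTheory.Limits CategoryTheory.PreGaloisCategory
open Literature.AnabelianGeometry.Anabelioids
open Literature.AlgebraicGeometry.Frobenioids (BCat IsSlimGroup)
open scoped FintypeCatDiscrete Pointwise

universe u

namespace ProfiniteSemiGraph

variable (𝒢 : ProfiniteSemiGraph.{u})

/-- `b^* = res (b_*)`: the pull-back functor of the §2 presentation of `𝒢` at a branch is the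
restriction functor along `b_*` (definitionally). [cite: MochizukiSemiAnbd2006, Def. 2.1 p.23] -/
theorem toAnab_pull_pullback (b : 𝒢.graph.Branch) (v : 𝒢.graph.Vertex)
    (h : 𝒢.graph.abuts b = some v) :
    (𝒢.toAnab.pull b v h).pullback = ContAction.res FintypeCat.{u} (𝒢.brHom b v h) := rfl

/-- **`Π_v` (§3) `=` `Π_v` (§2)**: the profinite vertex group of `𝒢` is the fundamental group of the
constituent anabelioid `B(Π_v)` of `𝒢.toAnab` at its forgetful basepoint, via the action.
[cite: MochizukiSemiAnbd2006, Def. 2.1 p.23] -/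
theorem exists_piV_equiv (v : 𝒢.graph.Vertex) :
    ∃ e : 𝒢.Gv v ≃ₜ* 𝒢.toAnab.PiV v
      (ObjectProperty.ι (Action.IsContinuous (V := FintypeCat.{u}) (G := 𝒢.Gv v)) ⋙
        Action.forget FintypeCat.{u} (𝒢.Gv v)),
      ∀ (g : 𝒢.Gv v) (X : BCat (𝒢.Gv v)), (e g).hom.app X = X.obj.ρ g :=
  exists_continuousMulEquiv_aut_forget (G := 𝒢.Gv v)

/-- The same for edge groups. [cite: MochizukiSemiAnbd2006, Def. 2.1 p.23] -/
theorem exists_piB_equiv (b : 𝒢.graph.Branch) :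
    ∃ e : 𝒢.Ge (𝒢.graph.edgeOf b) ≃ₜ* 𝒢.toAnab.PiB b
      (ObjectProperty.ι (Action.IsContinuous (V := FintypeCat.{u}) (G := 𝒢.Ge (𝒢.graph.edgeOf b))) ⋙
        Action.forget FintypeCat.{u} (𝒢.Ge (𝒢.graph.edgeOf b))),
      ∀ (g : 𝒢.Ge (𝒢.graph.edgeOf b)) (X : BCat (𝒢.Ge (𝒢.graph.edgeOf b))),
        (e g).hom.app X = X.obj.ρ g :=
  exists_continuousMulEquiv_aut_forget (G := 𝒢.Ge (𝒢.graph.edgeOf b))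

/-- **`Π_b` (§2) `=` image of `Π_b` (§3)**: at the forgetful basepoint of `𝒢_e` and the INDUCED
basepoint `b^* ⋙ forget` of `𝒢_v` (transport `Iso.refl`, t1's `branchSubgroup_refl` convention; note
`b^* ⋙ forget = forget` definitionally), the §2 branch subgroup of `𝒢.toAnab` is the image under
any action-compatible identification `Π_v ≃ Aut(b^* ⋙ forget)` of the §3 branch subgroup
`range b_*`.  (Other transports `α` / basepoints give its `Π_v`-conjugates:
`branchSubgroup_eq_conjAct_smul`, `FiberFunctorUnique`.) [cite: MochizukiSemiAnbd2006, Def. 2.1 pp.23-24] -/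
theorem branchSubgroup_toAnab_eq (b : 𝒢.graph.Branch) (v : 𝒢.graph.Vertex)
    (h : 𝒢.graph.abuts b = some v)
    (eV : 𝒢.Gv v ≃ₜ* 𝒢.toAnab.PiV v ((𝒢.toAnab.pull b v h).pullback ⋙
      (ObjectProperty.ι (Action.IsContinuous (V := FintypeCat.{u}) (G := 𝒢.Ge (𝒢.graph.edgeOf b))) ⋙
        Action.forget FintypeCat.{u} (𝒢.Ge (𝒢.graph.edgeOf b)))))
    (heV : ∀ (g : 𝒢.Gv v) (X : BCat (𝒢.Gv v)), (eV g).hom.app X = X.obj.ρ g) :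
    𝒢.toAnab.branchSubgroup
        ((𝒢.toAnab.pull b v h).pullback ⋙
          (ObjectProperty.ι (Action.IsContinuous (V := FintypeCat.{u}) (G := 𝒢.Ge (𝒢.graph.edgeOf b))) ⋙
            Action.forget FintypeCat.{u} (𝒢.Ge (𝒢.graph.edgeOf b)))) b h
        (ObjectProperty.ι (Action.IsContinuous (V := FintypeCat.{u}) (G := 𝒢.Ge (𝒢.graph.edgeOf b))) ⋙
          Action.forget FintypeCat.{u} (𝒢.Ge (𝒢.graph.edgeOf b))) (Iso.refl _) =
      (𝒢.branchSubgroup b v h).map eV.toMonoidHom := by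
  obtain ⟨eE, heE⟩ := 𝒢.exists_piB_equiv b
  rw [SemiGraphOfAnabelioids.branchSubgroup_refl]
  -- compare elementwise through `π₁(res b_*) (e_E x) = e_V (b_* x)` (equal components `ρ_X (b_* x)`)
  have key : ∀ x : 𝒢.Ge (𝒢.graph.edgeOf b),
      𝒢.toAnab.piBToPiV b v h _ (eE x) = eV (𝒢.brHom b v h x) := by
    intro x
    refine Iso.ext (NatTrans.ext (funext fun X => ?_))
    rw [heV]
    exact pi1Map_res_app (𝒢.brHom b v h) (eE x) x (heE x) X
  ext σ
  constructor
  · rintro ⟨y, rfl⟩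
    obtain ⟨x, rfl⟩ := eE.surjective y
    exact ⟨𝒢.brHom b v h x, ⟨x, rfl⟩, (key x).symm⟩
  · rintro ⟨_, ⟨x, rfl⟩, rfl⟩
    exact ⟨eE x, key x⟩

/-- Existence of the identification used in `branchSubgroup_toAnab_eq` (the induced basepoint
`b^* ⋙ forget` of `𝒢_v` IS the forgetful one). [cite: MochizukiSemiAnbd2006, Def. 2.1 p.23] -/
theorem exists_piV_equiv_induced (b : 𝒢.graph.Branch) (v : 𝒢.graph.Vertex)
    (h : 𝒢.graph.abuts b = some v) :
    ∃ eV : 𝒢.Gv v ≃ₜ* 𝒢.toAnab.PiV v ((𝒢.toAnab.pull b v h).pullback ⋙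
      (ObjectProperty.ι (Action.IsContinuous (V := FintypeCat.{u}) (G := 𝒢.Ge (𝒢.graph.edgeOf b))) ⋙
        Action.forget FintypeCat.{u} (𝒢.Ge (𝒢.graph.edgeOf b)))),
      ∀ (g : 𝒢.Gv v) (X : BCat (𝒢.Gv v)), (eV g).hom.app X = X.obj.ρ g :=
  exists_continuousMulEquiv_aut_forget (G := 𝒢.Gv v)

/-- **"Of injective type" agrees in the two presentations**: all `b^*` are `π₁`-monomorphisms iff
all `b_*` are injective. [cite: MochizukiSemiAnbd2006, Def. 2.1 p.22] -/
theorem isOfInjectiveType_toAnab_iff : 𝒢.toAnab.IsOfInjectiveType ↔ 𝒢.IsOfInjectiveType := by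
  rw [SemiGraphOfAnabelioids.isOfInjectiveType_iff]
  have h1 : ∀ (b : 𝒢.graph.Branch) (v : 𝒢.graph.Vertex) (h : 𝒢.graph.abuts b = some v),
      IsPi1Mono (𝒢.toAnab.pull b v h).pullback ↔ Function.Injective (𝒢.brHom b v h) := by
    intro b v h
    letI := galoisCategory_bCat (𝒢.Ge (𝒢.graph.edgeOf b))
    haveI := fiberFunctor_forget_bCat (𝒢.Ge (𝒢.graph.edgeOf b))
    exact isPi1Mono_res_iff_injective (𝒢.brHom b v h)
  exact ⟨fun H b v h => (h1 b v h).mp (H b v h), fun H b v h => (h1 b v h).mpr (H b v h)⟩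

/-- **"Verticially slim" agrees in the two presentations**: `B(Π_v)` is slim (at every basepoint)
iff `Π_v` is a slim profinite group. [cite: MochizukiSemiAnbd2006, Def 2.4(ii) p.25] -/
theorem isVerticiallySlim_toAnab_iff : 𝒢.toAnab.IsVerticiallySlim ↔ 𝒢.IsVerticiallySlim := by
  rw [SemiGraphOfAnabelioids.isVerticiallySlim_iff]
  exact ⟨fun H v => (isSlim_bCat_iff_isSlimGroup (𝒢.Gv v)).mp (H v),
    fun H v => (isSlim_bCat_iff_isSlimGroup (𝒢.Gv v)).mpr (H v)⟩

end ProfiniteSemiGraph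

end Literature.AnabelianGeometry.SemiGraphs

end
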